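import Summits.BirchSwinnertonDyer.BirchSwinnertonDyer.Theorems.SylvesterTwoHeegnerIndexUpperOffV0ShaBoundTwoSylvester
import Literature.NumberTheory.QuadraticFields.RingClassUnits
import Literature.NumberTheory.EllipticCurves.HeegnerPointsImaginaryQuadraticProofs
import HarnessLib

/-!
# K7t crux `UpperOffV0HSY` (item 19581): `ω ∉ K` for the Heegner fields of the stubs, and the
# (d) + (e) ⟹ `2^{2M₀+4} Ш(E_p/K)[2^∞] = 0` theorem with that hypothesis discharged

Route `SylvesterTwoHeegnerIndex` (cell bsd-cm, rung K7t), line `offv0-kolyvagin2`.  The registered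
stubs (d) `stub_kolyvaginClasses_two` / (e) `stub_kolyvaginReciprocity_two` quantify over imaginary
quadratic `K` with `d_K ∉ {-3, -4}`; the 2-adic Čebotarev theorems of the line need `ω ∉ K`
(`∀ x : K, x² + x + 1 ≠ 0`).  This file proves the implication — a root of `x² + x + 1` in `K` is a
unit of `𝓞 K` of order `3`, while `#𝓞 Kˣ ∈ {2, 4}` for `d_K ≠ -3` (the tree's
`QuadraticFields.RingClass.card_units_eq`, Cox §7.A) — and restates
`sha_two_exponent_bound_sylvester_of_stubs` (p468332) with `ω ∉ K` discharged: its hypotheses are now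
EXACTLY those of the stubs (`IsImaginaryQuadratic K`, `d_K ∉ {-3,-4}`, Heegner hypothesis, a Heegner
point of infinite order) plus the HSY model.

* `sq_add_self_add_one_ne_zero_of_discr_ne` — `IsImaginaryQuadratic K`, `d_K ≠ -3` ⟹ `ω ∉ K`;
* `sha_two_exponent_bound_sylvester_of_stubs'` — (d) + (e) ⟹ `Ш(E_p/K)[2^∞]` finite and killed by
  `2^{2M₀+4}`, for every `ℚ`-model of `cubeSumCurve p`, every stub-admissible `K`, `P`.

NOT the crux (B14 = O12 open as a class); no named fact, no definition.
-/

noncomputable section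

open scoped Classical
open WeierstrassCurve NumberField IsDedekindDomain Field Literature.NumberTheory.EllipticCurves
  Literature.NumberTheory.GaloisRepresentations
open Literature.NumberTheory.QuadraticFields Literature.NumberTheory.QuadraticFields.RingClass
  Literature.NumberTheory.QuadraticFields.Quadratic

set_option autoImplicit false
set_option linter.dupNamespace false

namespace Summit.BirchSwinnertonDyer.BirchSwinnertonDyer.Theorems.SylvesterTwoUpper

/-- **`ω ∉ K` for an imaginary quadratic field with `d_K ≠ -3`.**  A root `x` of `X² + X + 1` in `K`
is an algebraic integer with `x³ = 1`, `x ≠ 1`, i.e. a unit of `𝓞 K` of order `3`; but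
`#𝓞 Kˣ = 6, 4, 2` according as `d_K = -3, -4, < -4` (Cox, §7.A), so for `d_K ≠ -3` the order `3`
does not divide `#𝓞 Kˣ ∈ {4, 2}`. [cite: Cox2013, §7.A (units of imaginary quadratic orders)] -/
theorem sq_add_self_add_one_ne_zero_of_discr_ne {K : Type*} [Field K] [NumberField K]
    (hK : IsImaginaryQuadratic K) (hd : NumberField.discr K ≠ -3) (x : K) : x ^ 2 + x + 1 ≠ 0 := by
  intro hx
  have hx3 : x ^ 3 = 1 := by
    have : x ^ 3 - 1 = (x - 1) * (x ^ 2 + x + 1) := by ring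
    rw [← sub_eq_zero, this, hx, mul_zero]
  have hx1 : x ≠ 1 := by
    intro h1
    rw [h1] at hx
    norm_num at hx
  -- `x` is an algebraic integer: a root of the monic `X² + X + 1`
  have hint : IsIntegral ℤ x := by
    refine ⟨Polynomial.X ^ 2 + Polynomial.X + 1, ?_, ?_⟩
    · rw [add_assoc]
      exact Polynomial.monic_X_pow_add (by compute_degree!)
    · simp [hx]
  set y : 𝓞 K := ⟨x, hint⟩ with hy
  have hyx : (y : K) = x := rfl
  have hy3 : y ^ 3 = 1 := by
    apply NumberField.RingOfIntegers.coe_injective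
    simp only [map_pow, map_one]
    exact hx3
  have hy1 : y ≠ 1 := by
    intro h1
    apply hx1
    rw [← hyx, h1]
    rfl
  -- a unit of order `3`
  set u : (𝓞 K)ˣ := Units.ofPowEqOne y 3 hy3 (by norm_num) with hudef
  have hu3 : u ^ 3 = 1 := Units.pow_ofPowEqOne hy3 (by norm_num)
  have huval : (u : 𝓞 K) = y := by simp [hudef]
  have hu1 : u ≠ 1 := by
    intro h1
    apply hy1
    rw [← huval, h1, Units.val_one]
  haveI : Fact (Nat.Prime 3) := ⟨Nat.prime_three⟩
  have hord : orderOf u = 3 := orderOf_eq_prime hu3 hu1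
  have hdvd : 3 ∣ Nat.card (𝓞 K)ˣ := hord ▸ orderOf_dvd_natCard u
  -- `#𝓞 Kˣ ∈ {4, 2}` since `d_K ≠ -3`
  obtain ⟨b, hb⟩ := exists_basis_zero_eq_one hK.1
  have hω := basis_one_mul_self_eq b hb
  have hD := discr_eq_sq_add_four_mul b hb
  have hneg : (b.repr (b 1 * b 1) 1) ^ 2 + 4 * b.repr (b 1 * b 1) 0 < 0 := by
    rw [← hD]; exact hK.discr_neg
  rw [card_units_eq b hb hω hneg, if_neg (by rw [← hD]; exact hd)] at hdvd
  by_cases h4 : (b.repr (b 1 * b 1) 1) ^ 2 + 4 * b.repr (b 1 * b 1) 0 = -4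
  · rw [if_pos h4] at hdvd
    omega
  · rw [if_neg h4] at hdvd
    omega

/-- **(d) + (e) ⟹ `2^{2M₀+4} Ш(E_p/K)[2^∞] = 0` for the Sylvester curves, with `ω ∉ K` discharged**:
`sha_two_exponent_bound_sylvester_of_stubs` under exactly the stubs' hypotheses on `K`
(`IsImaginaryQuadratic K`, `d_K ∉ {-3, -4}`, Heegner hypothesis) and `P` (Heegner point of level
`N` of infinite order), for every `ℚ`-model of `cubeSumCurve p`, `p` an odd prime.
[cite: McCallumLMS1991, §1 Theorem (Kolyvagin)] [cite: GrossLMS1991, Thm. 1.3 (2)] -/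
theorem sha_two_exponent_bound_sylvester_of_stubs'
    (hD : ∀ (N : ℕ) [NeZero N] (W : WeierstrassCurve ℚ) [W.IsElliptic] (K : Type) [Field K]
      [NumberField K] (_hK : IsImaginaryQuadratic K)
      (_hD : NumberField.discr K ≠ -3 ∧ NumberField.discr K ≠ -4)
      (_hH : SatisfiesHeegnerHypothesis N K) {P : (W.baseChange K).toAffine.Point}
      (_hP : IsHeegnerPoint N W K P) (_hnt : ¬ IsOfFinAddOrder P) {M : ℕ} (_hM : 1 ≤ M)
      (hdiv : ∀ Q : geomPoints (W.baseChange K), ∃ R, ((2 ^ M : ℕ) : ℤ) • R = Q)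
      (c : K ≃ₐ[ℚ] K) (_hc : c ≠ 1),
      ∃ (ε : ℤ) (τ : AlgebraicClosure K ≃+* AlgebraicClosure K) (hτ : IsLiftOfAut c τ)
        (A : ℕ → AddSubgroup (geomPoints (W.baseChange K)))
        (hA : ∀ m, KolyvaginCocycle.IsAdmissible (Field.absoluteGaloisGroup K) (A m)
          ((2 ^ M : ℕ) : ℤ))
        (Pt : ℕ → geomPoints (W.baseChange K))
        (hPt : ∀ m, Pt m ∈
          KolyvaginCocycle.invPoints (Field.absoluteGaloisGroup K) (A m) ((2 ^ M : ℕ) : ℤ)),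
        (ε = 1 ∨ ε = -1) ∧
        IsOfFinAddOrder (Affine.Point.map (W' := W) (c : K →ₐ[ℚ] K) P - ε • P) ∧
        (∀ m, ∀ a ∈ A m, hτ.pointsMap W a ∈ A m) ∧ Pt 1 = toGeomPoints (W.baseChange K) P ∧
        (∀ m : ℕ, Squarefree m →
          (∀ q ∈ m.primeFactors, IsKolyvaginPrime N W K 2 q ∧ FrobEqFrobInfty W K (2 ^ M) q) →
          (∃ B ∈ A m, hτ.pointsMap W (Pt m) =
            (ε * (-1) ^ m.primeFactors.card) • Pt m + ((2 ^ M : ℕ) : ℤ) • B) ∧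
          (∀ v : HeightOneSpectrum (𝓞 K), (m : 𝓞 K) ∉ v.asIdeal →
            kolyvaginClass (W.baseChange K) _ hdiv (hA m) (Pt m) (hPt m) ∈
              selmerLocalKer (W.baseChange K) (v.adicCompletion K) ((2 ^ M : ℕ) : ℤ)) ∧
          (∀ ℓ : ℕ, ℓ.Prime → ℓ ∣ m → ∀ v : HeightOneSpectrum (𝓞 K), (ℓ : 𝓞 K) ∈ v.asIdeal →
            ∀ a : ℕ, ((((2 : ℕ) : ℤ) ^ a) •
                kolyvaginClass (W.baseChange K) _ hdiv (hA m) (Pt m) (hPt m) ∈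
                selmerLocalKer (W.baseChange K) (v.adicCompletion K) ((2 ^ M : ℕ) : ℤ) ↔
              (((2 : ℕ) : ℤ) ^ a) • kolyvaginClass (W.baseChange K) _ hdiv (hA (m / ℓ))
                  (Pt (m / ℓ)) (hPt (m / ℓ)) ∈
                (W.baseChange K).torsionLocalKer (v.adicCompletion K) ((2 ^ M : ℕ) : ℤ)))))
    (hE : ∀ (N : ℕ) [NeZero N] (W : WeierstrassCurve ℚ) [W.IsElliptic] (K : Type) [Field K]
      [NumberField K] (_hK : IsImaginaryQuadratic K)
      (_hD : NumberField.discr K ≠ -3 ∧ NumberField.discr K ≠ -4)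
      (_hH : SatisfiesHeegnerHypothesis N K) {P : (W.baseChange K).toAffine.Point}
      (_hP : IsHeegnerPoint N W K P) (_hnt : ¬ IsOfFinAddOrder P) {M : ℕ} (_hM : 1 ≤ M) {ℓ : ℕ}
      (hℓ : IsKolyvaginPrime N W K 2 ℓ), FrobEqFrobInfty W K (2 ^ M) ℓ →
      ∃ (A : Type) (_ : AddCommGroup A)
        (e : geomTorsion (W.baseChange K) ((2 ^ M : ℕ) : ℤ) →+
          geomTorsion (W.baseChange K) ((2 ^ M : ℕ) : ℤ) →+ A),
        (∀ x, e x x = 0) ∧ (∀ x, (∀ y, e x y = 0) → x = 0) ∧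
        ∀ s ∈ selmerGroup (W.baseChange K) ((2 ^ M : ℕ) : ℤ),
          ∀ c' : galH1Torsion (W.baseChange K) ((2 ^ M : ℕ) : ℤ),
          (∀ v : HeightOneSpectrum (𝓞 K), (ℓ : 𝓞 K) ∉ v.asIdeal →
            c' ∈ selmerLocalKer (W.baseChange K) (v.adicCompletion K) ((2 ^ M : ℕ) : ℤ)) →
          (∀ w : InfinitePlace K,
            c' ∈ selmerLocalKer (W.baseChange K) w.Completion ((2 ^ M : ℕ) : ℤ)) →
          ∀ 𝔔 ∈ hℓ.place.primesAbove, ∀ F : Field.absoluteGaloisGroup K,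
            IsArithFrobAt (𝓞 K) F 𝔔 → F ∈ torsionFixing (W.baseChange K) ((2 ^ M : ℕ) : ℤ) →
            ∀ σ ∈ 𝔔.inertia (Field.absoluteGaloisGroup K),
            e (h1Eval (W.baseChange K) ((2 ^ M : ℕ) : ℤ) s F)
              (h1Eval (W.baseChange K) ((2 ^ M : ℕ) : ℤ) c' σ) = 0)
    {p : ℕ} (hp : p.Prime) (hp2 : p ≠ 2) {N : ℕ} [NeZero N] (W : WeierstrassCurve ℚ) [W.IsElliptic]
    (hW : ∃ C : VariableChange ℚ, C • W = HuShuYin2019.cubeSumCurve (p : ℚ))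
    {K : Type} [Field K] [NumberField K] (hK : IsImaginaryQuadratic K)
    (hdK : NumberField.discr K ≠ -3 ∧ NumberField.discr K ≠ -4) (hH : SatisfiesHeegnerHypothesis N K)
    {P : (W.baseChange K).toAffine.Point} (hP : IsHeegnerPoint N W K P) (hnt : ¬ IsOfFinAddOrder P) :
    ∃ (M₀ : ℕ) (x₀ : (W.baseChange K).toAffine.Point),
      2 ^ M₀ • x₀ = P ∧ (∀ Q : (W.baseChange K).toAffine.Point, 2 ^ (M₀ + 1) • Q ≠ P) ∧
      (∀ cs : (W.baseChange K).sha, (∃ j : ℕ, 2 ^ j • cs = 0) → 2 ^ (2 * M₀ + 4) • cs = 0) ∧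
      Set.Finite {cs : (W.baseChange K).sha | ∃ j : ℕ, 2 ^ j • cs = 0} :=
  sha_two_exponent_bound_sylvester_of_stubs hD hE hp hp2 W hW hK hdK hH
    (sq_add_self_add_one_ne_zero_of_discr_ne hK hdK.1) hP hnt

end Summit.BirchSwinnertonDyer.BirchSwinnertonDyer.Theorems.SylvesterTwoUpper

end
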